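import Summits.BirchSwinnertonDyer.BirchSwinnertonDyer.Theorems.ClassRecordThreeEulerHalvesAtThreeCartanCarayolModular
import Summits.BirchSwinnertonDyer.BirchSwinnertonDyer.Theorems.ClassRecordThreeEulerHalvesAtThreeCartanCoverHeckeDatumCover
import Literature.NumberTheory.EllipticCurves.ComplexMultiplicationLFunctionIsogenyHoldsProofs
import HarnessLib

/-!
# Crux NUM `CartanOnePlaceDegreeLawAtThree` (stmt-BirchSwinnertonDyer-24801) ∕ `EulerHalvesAtThree` (19109) — THE LIFT SOCKET (AUTOCONV):
# «torsion- and cusp-null mod-3 Hecke eigen-cochain on the cover group ⇒ congruent weight-2 newform of level prime to the Cartan place», r2.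
# Ideator `bsd-idea-10` g20 (lens = transfer; the tree sibling is `Literature…CuspidalHomologyEigenpacketLift.exists_isNewform0_of_eigenvector_mod`).

The automorphic residue of the Galois leaf (OBS) `CartanCover.Charext.NoModThreePeriodCharacterExtension` common to BOTH roads — the inert-Hecke
certificate (`…CartanCoverHeckeDatum{,Cover,Certificate}`: (T12) eigen on all of `ι(O₀'¹)`, (T13) null on elliptic elements) and the Carayol–modularity road
(`…CartanCarayolModular`: OBS ⟸ MOD ⟸ thm61 ∧ CONG) — typed as ONE print statement over TREE vocabulary only (a cochain on `coverUnits X q`, the tree's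
`InertHecke.HeckeDatum` ∕ `HeckeDatum.op` ∕ `InertHecke.unitsHeckeSet`, and the conclusion shape of (CONG)), nothing asserted.

REVISION r2 (critic idea-crit-14 V214, 2026-08-29). r1 (p741779) stated (LIFT) `EigenCochainLiftPrimeToCartanPlaceAtThree` ∕ (EIG)
`PeriodCharacterEigenPackageAtThree` for EVERY Cartan datum, and `CartanLevelCurveData` admits `D = 1` (`B = M₂(ℚ)`): there `ι(O₀'¹)` has cusps and the
mod-`3` EISENSTEIN eigen-cochain (`T_ℓ = 1 + ℓ`; e.g. `D = 1`, `M = 11`, `C = {q}`, where `ι(O₀'¹) = Γ₀(11)`, `Γ̄₀(11)` is free and no newform of level `∣ 11` is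
Eisenstein mod `3`) is additive, `3`-torsion, non-zero, torsion-null and Hecke-eigen — so r1's LIFT is FALSE at `D = 1` (parabolic classes) and is WITHDRAWN together
with r1's EIG. This revision replaces both by their CUSPIDAL versions under NEW NAMES: the cochain is also required NULL ON EVERY PARABOLIC ELEMENT
(`Matrix.GeneralLinearGroup.IsParabolic`), i.e. it is a class of the COMPACTIFIED curve — Shimura's parabolic cohomology `H¹_P(Γ', A)` with trivial coefficients —
and (EIG) delivers that clause as well (recipe below; one new print∕Mathlib-level input (PAR) «periods of a cusp form over parabolic elements vanish»).


* «`H` IS `T_n` OF THE COVER» [two clauses, written inline in (LIFT) and (EIG), no new predicate]: the representatives `H.α i` of a Hecke datum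
  `H` on `coverUnits X q = ι(O₀'¹)` lie in `ι(O₀'(n))` (`InertHecke.unitsHeckeSet` of the cover order) and meet every left `ι(O₀'¹)`-coset of
  `ι(O₀'(n))` (so, with `H.disj`, they are a full family of representatives and on additive cochains `H.op` is `T_n` whatever the choices, (T8)
  `HeckeDatum.op_changeReps`). The (SIMREP)-built `ofStable` datum of the certificate satisfies them: `(g i)·q_i.out ∈ Γ·ι(O(n)) ⊆ ι(O₀'(n))`
  (`CartanCover.le_coverOrder`) and clause (iv) of `InertHecke.SimultaneousHeckeReps` IS the covering clause, verbatim.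
* (LIFT) `CuspidalEigenCochainLiftPrimeToCartanPlaceAtThree` [`@[conjecture] def`, PRINT CONTENT, the AUTOCONV stub of `Lines/lattice` v9]: for `q ∈ C` and an additive,
  `3`-torsion, NON-ZERO cochain `χ̄ : ι(O₀'¹) → A` that KILLS EVERY ELEMENT OF FINITE ORDER AND EVERY PARABOLIC ELEMENT and is `T_ℓ`-eigen with integer eigenvalue `a ℓ` for
  all primes `ℓ` outside a finite set, there is a weight-2 newform `f` of level `M_f ∣ D·M·∏_{p ∈ C∖q} p²` (prime to `q`) and a prime `λ ∣ 3` of its coefficients with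
  `a_ℓ(f) ≡ a ℓ`, `ε_f(ℓ)ℓ ≡ ℓ (mod λ)` for almost all `ℓ` — in the integral-Hecke-polynomial idiom of (CONG). PRINT PROOF (the transfer dictionary, memo
  `Cruxes/EulerHalvesAtThree/LIFT-TRANSFER.md`): `χ̄` kills `±1`, the elliptic and the parabolic elements, so it is a class in `H¹(X̄', A) = Hom(H₁(X̄', ℤ), A)`, `X̄'` the
  compactified cover curve `ι(O₀'¹)∖ℍ*` (Armstrong: `π₁(X̄') = Γ'∕⟨⟨torsion, parabolics⟩⟩`; for `D > 1` there are no parabolic elements and `X' = ι(O₀'¹)∖ℍ` is already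
  compact) — Shimura's `H¹_P(Γ', A)`, Hecke-equivariantly [Shimura §8.1–8.3]; a functional `A[3] → 𝔽₃` makes it a non-zero `𝔽₃`-eigenclass; Deligne–Serre 6.11 on the free
  `ℤ`-module `H¹(X̄', ℤ)` with its (commutative, finite) Hecke algebra — IN THE TREE, generic: `Literature.Algebra.Module.DeligneSerreLifting.deligneSerre_lifting_of_free`
  — lifts the eigenvalues to an eigenclass in `H¹(X̄', ℂ) = S₂(Γ') ⊕ S₂(Γ')⁻` [Eichler–Shimura: Shimura Thm. 8.4 for any Fuchsian group of the first kind ∕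
  Matsushima–Murakami, cocompact case], i.e. a `T_ℓ`-eigen CUSP form on `ι(O₀'¹)` (trivial central character: right-`Ô₀'^×`-invariant forms on `B^×_𝔸`, class number one);
  for `D > 1` Jacquet–Langlands [JL 1970 §16, Shimizu] moves it to a cuspidal eigenform on `GL₂` whose conductor is `p` at `p ∣ D`, `≤ p^{v_p(M)}` at the Eichler places, `≤
  p²` at `p ∈ C∖q` (a `K(p)`-fixed vector, depth zero) and `1` at `q` (where `O₀'` is MAXIMAL — the point of the cover) [Casselman 1973, Thm. 1]; Atkin–Lehner gives the
  newform. The sibling for `Γ₀(L)` is a THEOREM of the tree (`exists_isNewform0_of_eigenvector_mod`: DS + joint eigenvector in `S₂(Γ₀(L))` + Atkin–Lehner); the two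
  non-transferring steps are exactly Eichler–Shimura for the COCOMPACT cover group and Jacquet–Langlands at Cartan level — both print theorems, neither typed in the tree.
* (EIG) `PeriodCharacterCuspidalEigenPackageAtThree` [definition, CERTIFICATE CURRENCY — the target of the LEAD's kernel glue, NOT a print input]: under the hypotheses of
  (CONG) VERBATIM, such a package `(A, χ̄, S)` exists with eigenvalues `a_ℓ(W₁)`. Its proof is the certificate: `χ̄ := χ mod 3Λ` ((T14) `redThree_cochain`), non-zero by the
  last hypothesis of (CONG) ((T14b) + `redThree_eq_zero_iff`), eigen by (T12′) + (T11c′) + (T14c) + (SIMREP) + `Q.hecke_eq`, null on elements of order `3`, `6` by (T13′) +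
  (T6) + (CHEB) + the `ℙ¹(𝔽_ℓ)`-cosets, on `±1` and order `4` by `2χ̄(x) = χ̄(±1) = 0 = 3χ̄(x)`; null on a PARABOLIC `x`: by Cayley–Hamilton `(x ∓ 1)² = 0`, so `x^{2q} = 1
  + q·(2(±x − 1)) ∈ Γ̄(q)` (`CartanCover.principalLevel`) is parabolic and `χ̄(x^{2q}) = (c·per_F(x^{2q}))‾ = 0` by (PAR) «the period `∫_{z₀}^{βz₀} F` of the cusp form `F =
  Q.form` over a parabolic `β ∈ Γ` vanishes» (`CuspForm.zero_at_cusps'` at the cusp fixed by `β`, periodicity of `F|g`, Cauchy; vacuous for `D > 1`), whence `2q·χ̄(x) = 0 =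
  3χ̄(x)` and `χ̄(x) = 0` (`q ≠ 3`).
* PROVED here (unchanged from r1 but for the names): `congruentNewform_of_cuspLift : LIFT → EIG → CONG` (the eigenvalue translation
  `a_ℓ(W₁) = a_ℓ(V) = a_v(V)` by isogeny invariance `LFunction_eq_of_isIsogenous_holds` + `lFunction_primesEquiv_eq_frobeniusTraceAt` at the good places, `#k_v = ℓ_v`, and
  `q ∤ M_f` from `X.coprime`, `not_dvd_of_dvd_coverLevel`); hence `noModThreePeriodCharacterExtension_of_cuspLift : thm61 → LIFT → EIG → OBS` and
  `saturationAtThree_of_cuspLift`.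
* KEPT from r1 (Theorems files are append-only), §1–§4 below VERBATIM: `EigenCochainLiftPrimeToCartanPlaceAtThree` (FALSE at `D = 1`, see above — deprecated in
  favour of the cuspidal statement; never list it as a stub), `PeriodCharacterEigenPackageAtThree` (deprecated likewise) and the r1 glue theorems `…_of_lift`
  (valid, moot). The live socket is §5–§7: `congruentNewform_of_cuspLift`, `noModThreePeriodCharacterExtension_of_cuspLift`, `saturationAtThree_of_cuspLift`.
So after this file the Galois leaf reads OBS ⟸ {thm61 (named fact), LIFT (print), EIG (certificate: SIMREP, CHEB — a theorem since p741814 —, RED_ℓ ∕ ℙ¹-cosets,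
(PAR) + parts A–C)} — kernel-checked.
(LIFT)'s hypotheses are satisfiable in print (the cover's `T_ℓ` has `ℓ + 1` cosets for `ℓ ∤ q·D·M·∏C`) and its conclusion is cofinite, so the finitely many
`ℓ` at which `ι(O₀'(ℓ))` is empty or `T_ℓ` degenerates (`ℓ ∣ D·M·∏_{C∖q} p`) impose nothing. BSD is proved for no curve.
[cite: ShimuraIATAF1971, §8.2 Thm. 8.4 and §8.3 (8.3.2)] [cite: MatsushimaMurakami1963] [cite: DeligneSerre1974, Lemme 6.11] [cite: JacquetLanglands1970, §16]
[cite: Casselman1973, Thm. 1] [cite: DiamondTaylor1994, §1–§4] [cite: Ribet1990, Thm. 1.1] [cite: DiamondShurman2005, Thm. 5.8.2, Thm. 6.5.4]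
-/

set_option linter.dupNamespace false
set_option autoImplicit false

noncomputable section

open scoped Classical MatrixGroups ModularForm NumberField

namespace Summit.BirchSwinnertonDyer.BirchSwinnertonDyer.Theorems.CartanCarayol

open Summit.BirchSwinnertonDyer.BirchSwinnertonDyer.Theorems
open Summit.BirchSwinnertonDyer.BirchSwinnertonDyer.Theorems.CartanCover.Charext
open Summit.BirchSwinnertonDyer.BirchSwinnertonDyer.Theorems.CartanCover.Charext.InertHecke
open Literature.NumberTheory.Automorphic WeierstrassCurve Literature.NumberTheory.EllipticCurves
open Literature.NumberTheory.EllipticCurves.ModularForms Literature.NumberTheory.EllipticCurves.Rank1Residual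
open NumberField IsDedekindDomain CongruenceSubgroup Rat.HeightOneSpectrum

variable {D M : ℕ} {C : Finset ℕ}

/-! ## §1 (LIFT) the print statement: torsion-null mod-`3` eigen-cochains on the cover come from newforms of level prime to `q` -/

/-- **WITHDRAWN (r2, critic V214): FALSE at `D = 1` (Eisenstein eigen-cochains on `Γ₀(11)`; the parabolic-null clause is missing) — superseded by
`CuspidalEigenCochainLiftPrimeToCartanPlaceAtThree` (§5); kept with its r1 text because Theorems files are append-only.**
(LIFT r1) `EigenCochainLiftPrimeToCartanPlaceAtThree` [nothing asserted]. For a Cartan datum `X` of level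
`(D, M; C)`, `q ∈ C`, an abelian group `A` and a cochain `χ̄ : ι(O₀'¹) → A` on the cover group `coverUnits X q` which is ADDITIVE, `3`-TORSION, NON-ZERO,
NULL ON EVERY ELEMENT OF FINITE ORDER (`±1` and the elliptic elements of orders `3, 4, 6`), and, for every prime `ℓ` outside a finite set `S`, an
eigen-cochain `T_ℓ χ̄ = a(ℓ)·χ̄` of the Hecke operator of the cover (`H.op` for some — equivalently any — datum `H` whose representatives lie in
`ι(O₀'(ℓ))` and meet every `ι(O₀'¹)`-coset of it) with integer eigenvalues `a(ℓ)`: there are a weight-2 NEWFORM `f ∈ S₂(Γ₁(M_f))` of level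
`M_f ∣ D·M·∏_{p ∈ C∖q} p²` (so `q ∤ M_f`), a discrete field `k` receiving `j : 𝔽₃ → k` and `ι_f : 𝓞_f → k` (a prime `λ ∣ 3` of the coefficient ring) such
that for all but finitely many primes `ℓ` the integral Hecke polynomial `P_ℓ ↦ X² − a_ℓ(f)X + ε_f(ℓ)ℓ` of `f` reduces under `ι_f` to `X² − j(a(ℓ))X + j(ℓ)`.
PRINT: `χ̄ ∈ H¹(X_{O₀'}, A) = Hom(H₁(X_{O₀'}, ℤ), A)` (a homomorphism to an abelian group killing all torsion of the cocompact Fuchsian group `ι(O₀'¹)∕±1` factors through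
the surface group of the compact curve `X_{O₀'} = ι(O₀'¹)∖ℍ`), Hecke-equivariantly [Shimura §8.1–§8.3]; compose with a functional `A[3] → 𝔽₃` non-zero on `χ̄`;
Deligne–Serre 6.11 on the free module `H¹(X_{O₀'}, ℤ)` (tree: `Literature.Algebra.Module.DeligneSerreLifting.deligneSerre_lifting_of_free`) lifts `(a(ℓ) mod 3)_ℓ` to the
eigenvalues of an eigenclass in `H¹(X_{O₀'}, ℂ) = S₂ ⊕ S̄₂` [Eichler–Shimura, cocompact case: Shimura Thm. 8.4; Matsushima–Murakami], i.e. of an eigenform on `ι(O₀'¹)`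
with trivial central character; Jacquet–Langlands + the conductor bounds (`p ∥` at `p ∣ D`; `≤ v_p(M)` at Eichler places; `≤ 2` at `p ∈ C∖q`, depth zero; `0` at `q`,
where `O₀'` is maximal) [JL 1970 §16; Casselman 1973 Thm. 1] and Atkin–Lehner give the newform and the cofinite congruence. Why it might fail: it should not — each step
is a print theorem; the typing risks are the Hecke-equivariance of `H¹(ι(O₀'¹), ·) → H¹(X_{O₀'}, ·)` and the conductor exponent `≤ 2` at the Cartan places `p ≠ q`
(irrelevant to `q ∤ M_f`). NOT IN THE TREE: Eichler–Shimura for cocompact arithmetic `Γ` and Jacquet–Langlands at Cartan level (the tree has the adelic statement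
`Lang.jacquetLanglands_global` and the definite-algebra `jacquetLanglands_newform_of_weightEigenformLite` only).
[cite: ShimuraIATAF1971, §8.2 Thm. 8.4, §8.3 (8.3.2)] [cite: MatsushimaMurakami1963] [cite: DeligneSerre1974, Lemme 6.11] [cite: JacquetLanglands1970, §16]
[cite: Casselman1973, Thm. 1] [cite: DiamondTaylor1994, §1–§4] [cite: DiamondShurman2005, Thm. 5.8.2] -/
@[conjecture]
def EigenCochainLiftPrimeToCartanPlaceAtThree : Prop :=
  ∀ (D M : ℕ) (C : Finset ℕ) (X : CartanLevelCurveData D M C) (q : ℕ) [Fact q.Prime], q ∈ C →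
    ∀ (A : Type) [AddCommGroup A] (χ : CartanCover.coverUnits X q → A) (a : ℕ → ℤ) (S : Finset ℕ),
      (∀ x y, χ (x * y) = χ x + χ y) → (∀ x, 3 • χ x = 0) → (∃ x, χ x ≠ 0) →
      (∀ x, IsOfFinOrder x → χ x = 0) →
      (∀ ℓ : ℕ, ℓ.Prime → ℓ ∉ S →
        ∃ (ι : Type) (_ : Fintype ι) (H : HeckeDatum (CartanCover.coverUnits X q) ι),
          (∀ i, H.α i ∈ unitsHeckeSet X.ι (O := CartanCover.coverOrder X q) ℓ) ∧
          (∀ g ∈ unitsHeckeSet X.ι (O := CartanCover.coverOrder X q) ℓ, ∃ i, ∃ u ∈ CartanCover.coverUnits X q, u * g = H.α i) ∧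
          ∀ x, H.op χ x = a ℓ • χ x) →
      ∃ (Mf : ℕ) (_ : NeZero Mf) (f : CuspForm (Gamma1 Mf) 2) (_ : IsNewform1 f)
        (k : Type) (_ : Field k) (_ : TopologicalSpace k) (_ : DiscreteTopology k)
        (j : ZMod 3 →+* k) (ιf : coeffCharIntegers f →+* k),
        Mf ∣ D * M * ∏ p ∈ C.erase q, p ^ 2 ∧
          ∀ᶠ ℓ : Nat.Primes in Filter.cofinite,
            ∃ P : Polynomial (coeffCharIntegers f),
              P.map (algebraMap (coeffCharIntegers f) (coeffCharField f)) = heckePolynomial f ℓ ∧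
                P.map ιf = Polynomial.X ^ 2 - Polynomial.C (j ((a ℓ : ℤ) : ZMod 3)) * Polynomial.X +
                  Polynomial.C (j ((ℓ : ℕ) : ZMod 3))

/-! ## §2 (EIG) the certificate's output, typed: the period-character extension yields such a package -/

/-- **SUPERSEDED (r2) by `PeriodCharacterCuspidalEigenPackageAtThree` (§6), which adds the parabolic-null conjunct; kept because Theorems files are append-only.**
(EIG r1) `PeriodCharacterEigenPackageAtThree` [CERTIFICATE CURRENCY; nothing asserted, not a print input]. Binders and hypotheses VERBATIM those of
(CONG) `CongruentNewformOfLevelPrimeToCartanPlaceAtThree` (so of (MOD) ∕ (CAR)); conclusion: there are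
an abelian group `A`, a cochain `χ̄ : ι(O₀'¹) → A` on `coverUnits X q` and a finite set `S` of primes with `χ̄` additive, `3`-torsion, non-zero, null on
every element of finite order, and `T_ℓ χ̄ = a_ℓ(W₁)·χ̄` (a datum representing `ι(O₀'¹)∖ι(O₀'(ℓ))`, eigenvalue `W₁.LFunction ℓ`) for every prime `ℓ ∉ S` — exactly the
input of (LIFT). ITS PROOF IS THE CERTIFICATE (parts A–C `…CartanCoverHeckeDatum{,Cover,Certificate}` + (SIMREP) + (CHEB) + the `ℙ¹(𝔽_ℓ)`-cosets):
`A := ℂ ∕ 3Λ`, `χ̄ := χ mod 3Λ` (T14a `redThree_cochain`: additive, `3`-torsion); non-zero because `χ̄ = (c·per_F)‾` on `Γ̄(q)` (T14b) and the last hypothesis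
says `(c·per_F)‾ ≠ 0` there (`redThree_eq_zero_iff`); eigen at every prime `ℓ ∤ q·D·M·∏C` with eigenvalue `a_ℓ(W₁)` by (T12′) `cover_op_eq_smul_of_agree_on`
fed with (SIMREP)'s representatives (clauses (i), (ii), (iv); `CartanCover.le_coverOrder`), (T11c′) + (T14c) and `Q.hecke_eq`; null on `x` with `x³ = ±1` by (T13′)
at ONE prime `ℓ ≡ 2 (3)`, `3 ∤ a_ℓ(W₁) = a_ℓ(V)` ((CHEB) for `Surj V 3`, isogeny invariance) with `hfix` from (T6) and the `ℙ¹(𝔽_ℓ)`-identification of the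
`ℓ + 1` cosets; null on `±1` and on `x` with `x² = -1` since `2χ̄(x) = χ̄(x²) ∈ {χ̄(1), χ̄(-1)} = 0` and `3χ̄(x) = 0`; these are all the finite orders in
`ι(O₀'¹)` (`φ(n) ≤ 2`). Why it might fail: only through (SIMREP) ∕ (CHEB) ∕ the coset identification, each a print theorem. [folklore] -/
@[conjecture]
def PeriodCharacterEigenPackageAtThree : Prop :=
  ∀ (V : WeierstrassCurve ℚ) [V.IsElliptic], Surj V 3 →
    ∀ (N D M : ℕ) (C : Finset ℕ) (q : ℕ) [Fact q.Prime]
      (X : CartanLevelCurveData D M C) (W₁ : WeierstrassCurve ℚ) [W₁.IsElliptic] (Q : CartanParametrizationData X W₁),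
      q ∈ C → V.conductorNorm ℤ = N → D * M * ∏ p ∈ C, p ^ 2 = N → q ≠ 3 → Q.IsMinimalFor V →
      ∀ (c : ℂ) (χ : GL (Fin 2) ℝ → ℂ),
        (∀ γ ∈ CartanCover.coverUnits X q, χ γ ∈ Q.L.lattice) →
        (∀ γ ∈ CartanCover.coverUnits X q, ∀ δ ∈ CartanCover.coverUnits X q,
          ∃ y ∈ Q.L.lattice, χ (γ * δ) - χ γ - χ δ = 3 * y) →
        (∀ β ∈ CartanCover.principalLevel X q,
          ∃ y ∈ Q.L.lattice, χ β - c * segmentIntegral (⇑Q.form) Q.basePoint (β • Q.basePoint) = 3 * y) →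
        (¬ ∀ β ∈ CartanCover.principalLevel X q,
          ∃ y ∈ Q.L.lattice, c * segmentIntegral (⇑Q.form) Q.basePoint (β • Q.basePoint) = 3 * y) →
        ∃ (A : Type) (_ : AddCommGroup A) (χbar : CartanCover.coverUnits X q → A) (S : Finset ℕ),
          (∀ x y, χbar (x * y) = χbar x + χbar y) ∧ (∀ x, 3 • χbar x = 0) ∧ (∃ x, χbar x ≠ 0) ∧
            (∀ x, IsOfFinOrder x → χbar x = 0) ∧
            ∀ ℓ : ℕ, ℓ.Prime → ℓ ∉ S →
              ∃ (ι : Type) (_ : Fintype ι) (H : HeckeDatum (CartanCover.coverUnits X q) ι),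
                (∀ i, H.α i ∈ unitsHeckeSet X.ι (O := CartanCover.coverOrder X q) ℓ) ∧
                (∀ g ∈ unitsHeckeSet X.ι (O := CartanCover.coverOrder X q) ℓ, ∃ i, ∃ u ∈ CartanCover.coverUnits X q, u * g = H.α i) ∧
                ∀ x, H.op χbar x = (W₁.LFunction ℓ : ℤ) • χbar x

/-! ## §3 Bookkeeping: the level is prime to `q`; eigenvalues of `W₁` are Frobenius traces of `V` -/

/-- a divisor of `D·M·∏_{p ∈ C∖q} p²` is prime to `q` (`q ∈ C` is a prime not dividing `D·M`, and the Cartan places are primes: `X.coprime`). [folklore] -/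
theorem not_dvd_of_dvd_coverLevel (X : CartanLevelCurveData D M C) {q : ℕ} (hq : q ∈ C) {Mf : ℕ}
    (h : Mf ∣ D * M * ∏ p ∈ C.erase q, p ^ 2) : ¬ q ∣ Mf := by
  obtain ⟨hqp, hqDM⟩ := X.coprime q hq
  intro hdvd
  rcases (Nat.Prime.dvd_mul hqp).mp (dvd_trans hdvd h) with h1 | h1
  · exact hqDM h1
  · obtain ⟨p, hp, hqp2⟩ := (Prime.dvd_finsetProd_iff hqp.prime _).mp h1
    obtain ⟨hpq, hpC⟩ := Finset.mem_erase.mp hp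
    exact hpq ((Nat.prime_dvd_prime_iff_eq hqp (X.coprime p hpC).1).mp (hqp.dvd_of_dvd_pow hqp2)).symm

/-- at a good place `v` of `V`, for `W₁` isogenous to `V`: `a_{ℓ_v}(W₁) = a_v(V)` (isogeny invariance of `L(E, s)`, `LFunction_eq_of_isIsogenous_holds`,
and `a_p(E) = a_v`, `lFunction_primesEquiv_eq_frobeniusTraceAt`). [cite: Knapp1993, Thm. 11.67] -/
theorem lFunction_primesEquiv_eq_frobeniusTraceAt_of_isIsogenous {V W₁ : WeierstrassCurve ℚ} [V.IsElliptic] [W₁.IsElliptic]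
    (hiso : V.IsIsogenous W₁) {v : HeightOneSpectrum (𝓞 ℚ)} (hv : V.HasGoodReductionAt v) :
    W₁.LFunction (primesEquiv v : ℕ) = V.frobeniusTraceAt v := by
  rw [← LFunction_eq_of_isIsogenous_holds V W₁ hiso]
  exact V.lFunction_primesEquiv_eq_frobeniusTraceAt hv

/-! ## §4 The composition (PROVED): LIFT ∧ EIG ⟹ CONG ⟹ (with thm61) OBS, (D4) -/

/-- **CONG from LIFT and the certificate's package.** Apply (EIG) to the hypotheses of (CONG), feed the package to (LIFT) with `a := (a_ℓ(W₁))_ℓ`, and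
translate: `q ∤ M_f` (`not_dvd_of_dvd_coverLevel`); along `primesEquiv` the cofinite set of primes is a cofinite set of places, at the good ones
`a_{ℓ_v}(W₁) = a_v(V)` (`lFunction_primesEquiv_eq_frobeniusTraceAt_of_isIsogenous`, `Q.IsMinimalFor V` gives the isogeny) and `#k_v = ℓ_v`
(`natCard_residueField_adicCompletionIntegers`). [folklore] -/
theorem congruentNewform_of_lift (hLIFT : EigenCochainLiftPrimeToCartanPlaceAtThree) (hEIG : PeriodCharacterEigenPackageAtThree) :
    CongruentNewformOfLevelPrimeToCartanPlaceAtThree := by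
  intro V _ hS N D M C q _ X W₁ _ Q hq hN hDMC hq3 hmin c χ hχΛ hχadd hχres hne
  obtain ⟨A, _, χb, S, hadd, h3, hne', htor, heig⟩ :=
    hEIG V hS N D M C q X W₁ Q hq hN hDMC hq3 hmin c χ hχΛ hχadd hχres hne
  obtain ⟨Mf, hMf, f, hf, k, _, _, _, j, ιf, hlev, hcong⟩ :=
    hLIFT D M C X q hq A χb (fun ℓ ↦ W₁.LFunction ℓ) S hadd h3 hne' htor heig
  refine ⟨Mf, hMf, f, hf, k, inferInstance, inferInstance, inferInstance, j, ιf, not_dvd_of_dvd_coverLevel X hq hlev, ?_⟩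
  have hcong' : ∀ᶠ v : HeightOneSpectrum (𝓞 ℚ) in Filter.cofinite, ∃ P : Polynomial (coeffCharIntegers f),
      P.map (algebraMap (coeffCharIntegers f) (coeffCharField f)) = heckePolynomial f (primesEquiv v) ∧
        P.map ιf = Polynomial.X ^ 2 - Polynomial.C (j ((W₁.LFunction (primesEquiv v : ℕ) : ℤ) : ZMod 3)) * Polynomial.X +
          Polynomial.C (j (((primesEquiv v : Nat.Primes) : ℕ) : ZMod 3)) :=
    (primesEquiv.injective.tendsto_cofinite).eventually hcong
  filter_upwards [hcong', V.eventually_hasGoodReductionAt (K := ℚ)] with v hP hv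
  obtain ⟨P, hP1, hP2⟩ := hP
  refine ⟨P, hP1, ?_⟩
  rw [hP2, lFunction_primesEquiv_eq_frobeniusTraceAt_of_isIsogenous hmin.1 hv, natCard_residueField_adicCompletionIntegers v]

/-- OBS from LIFT and the package, granted Deligne's theorem (`noModThreePeriodCharacterExtension_of_congruentNewform`). -/
theorem noModThreePeriodCharacterExtension_of_lift (h61 : DeligneSerre1974.thm61_exists_adicGaloisRep)
    (hLIFT : EigenCochainLiftPrimeToCartanPlaceAtThree) (hEIG : PeriodCharacterEigenPackageAtThree) :
    CartanCover.Charext.NoModThreePeriodCharacterExtension :=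
  noModThreePeriodCharacterExtension_of_congruentNewform h61 (congruentNewform_of_lift hLIFT hEIG)

/-- `(M) → (M0) → LIFT → EIG → D4`, granted Deligne's theorem (`saturationAtThree_of_congruentNewform`). -/
theorem saturationAtThree_of_lift (h61 : DeligneSerre1974.thm61_exists_adicGaloisRep)
    (hM : CartanCover.PeriodLatticeCharacter) (hM0 : CartanCover.Charext.StrongApproxAtCartanPlace)
    (hLIFT : EigenCochainLiftPrimeToCartanPlaceAtThree) (hEIG : PeriodCharacterEigenPackageAtThree) : CartanCover.SaturationAtThree :=
  saturationAtThree_of_congruentNewform h61 hM hM0 (congruentNewform_of_lift hLIFT hEIG)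

/-! ## §5 (LIFT′) r2 — the CUSPIDAL print statement: torsion- and cusp-null mod-`3` eigen-cochains on the cover come from newforms of level prime to `q` -/

/-- **(LIFT) `CuspidalEigenCochainLiftPrimeToCartanPlaceAtThree`** [PRINT CONTENT, nothing asserted; the AUTOCONV leaf]. For a Cartan datum `X` of level
`(D, M; C)`, `q ∈ C`, an abelian group `A` and a cochain `χ̄ : ι(O₀'¹) → A` on the cover group `coverUnits X q` which is ADDITIVE, `3`-TORSION, NON-ZERO, NULL ON EVERY
ELEMENT OF FINITE ORDER (`±1` and the elliptic elements of orders `3, 4, 6`), NULL ON EVERY PARABOLIC ELEMENT (the stabilisers of the cusps when `D = 1`; there are none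
when `D > 1`), and, for every prime `ℓ` outside a finite set `S`, an eigen-cochain `T_ℓ χ̄ = a(ℓ)·χ̄` of the Hecke operator of the cover (`H.op` for some — equivalently any
— datum `H` whose representatives lie in `ι(O₀'(ℓ))` and meet every `ι(O₀'¹)`-coset of it) with integer eigenvalues `a(ℓ)`: there are a weight-2 NEWFORM `f ∈ S₂(Γ₁(M_f))`
of level `M_f ∣ D·M·∏_{p ∈ C∖q} p²` (so `q ∤ M_f`), a discrete field `k` receiving `j : 𝔽₃ → k` and `ι_f : 𝓞_f → k` (a prime `λ ∣ 3` of the coefficient ring) such that for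
all but finitely many primes `ℓ` the integral Hecke polynomial `P_ℓ ↦ X² − a_ℓ(f)X + ε_f(ℓ)ℓ` of `f` reduces under `ι_f` to `X² − j(a(ℓ))X + j(ℓ)`. PRINT: `χ̄ ∈
H¹(X̄_{O₀'}, A) = Hom(H₁(X̄_{O₀'}, ℤ), A)` (a homomorphism to an abelian group killing the torsion and the parabolic elements of the Fuchsian group `ι(O₀'¹)∕±1` factors
through the surface group of the compactified curve `X̄_{O₀'} = ι(O₀'¹)∖ℍ*` — Armstrong; this is Shimura's parabolic cohomology `H¹_P` with trivial coefficients),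
Hecke-equivariantly [Shimura §8.1–§8.3]; compose with a functional `A[3] → 𝔽₃` non-zero on `χ̄`; Deligne–Serre 6.11 on the free module `H¹(X̄_{O₀'}, ℤ)` (tree:
`Literature.Algebra.Module.DeligneSerreLifting.deligneSerre_lifting_of_free`) lifts `(a(ℓ) mod 3)_ℓ` to the eigenvalues of an eigenclass in `H¹(X̄_{O₀'}, ℂ) = S₂ ⊕ S̄₂`
[Eichler–Shimura: Shimura Thm. 8.4 (`H¹_P`, any Fuchsian group of the first kind); Matsushima–Murakami (cocompact)], i.e. of an eigen cusp form on `ι(O₀'¹)` with trivial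
central character; Jacquet–Langlands (`D > 1`) + the conductor bounds (`p ∥` at `p ∣ D`; `≤ v_p(M)` at Eichler places; `≤ 2` at `p ∈ C∖q`, depth zero; `0` at `q`, where
`O₀'` is maximal) [JL 1970 §16; Casselman 1973 Thm. 1] and Atkin–Lehner give the newform and the cofinite congruence. Why it might fail: r1 (no parabolic clause) DID fail
at `D = 1` — the Eisenstein eigen-cochain on `Γ₀(11)` (critic V214); with the clause each step is a print theorem; the typing risks are the Hecke-equivariance of
`H¹(ι(O₀'¹), ·) → H¹(X_{O₀'}, ·)` and the conductor exponent `≤ 2` at the Cartan places `p ≠ q` (irrelevant to `q ∤ M_f`). NOT IN THE TREE: Eichler–Shimura for general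
arithmetic `Γ` and Jacquet–Langlands at Cartan level (the tree has the adelic statement `Lang.jacquetLanglands_global` and the definite-algebra
`jacquetLanglands_newform_of_weightEigenformLite` only).
[cite: ShimuraIATAF1971, §8.2 Thm. 8.4, §8.3 (8.3.2)] [cite: MatsushimaMurakami1963] [cite: DeligneSerre1974, Lemme 6.11] [cite: JacquetLanglands1970, §16]
[cite: Casselman1973, Thm. 1] [cite: DiamondTaylor1994, §1–§4] [cite: DiamondShurman2005, Thm. 5.8.2] -/
@[conjecture]
def CuspidalEigenCochainLiftPrimeToCartanPlaceAtThree : Prop :=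
  ∀ (D M : ℕ) (C : Finset ℕ) (X : CartanLevelCurveData D M C) (q : ℕ) [Fact q.Prime], q ∈ C →
    ∀ (A : Type) [AddCommGroup A] (χ : CartanCover.coverUnits X q → A) (a : ℕ → ℤ) (S : Finset ℕ),
      (∀ x y, χ (x * y) = χ x + χ y) → (∀ x, 3 • χ x = 0) → (∃ x, χ x ≠ 0) →
      (∀ x, IsOfFinOrder x → χ x = 0) →
      (∀ x : CartanCover.coverUnits X q, Matrix.GeneralLinearGroup.IsParabolic (x : GL (Fin 2) ℝ) → χ x = 0) →
      (∀ ℓ : ℕ, ℓ.Prime → ℓ ∉ S →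
        ∃ (ι : Type) (_ : Fintype ι) (H : HeckeDatum (CartanCover.coverUnits X q) ι),
          (∀ i, H.α i ∈ unitsHeckeSet X.ι (O := CartanCover.coverOrder X q) ℓ) ∧
          (∀ g ∈ unitsHeckeSet X.ι (O := CartanCover.coverOrder X q) ℓ, ∃ i, ∃ u ∈ CartanCover.coverUnits X q, u * g = H.α i) ∧
          ∀ x, H.op χ x = a ℓ • χ x) →
      ∃ (Mf : ℕ) (_ : NeZero Mf) (f : CuspForm (Gamma1 Mf) 2) (_ : IsNewform1 f)
        (k : Type) (_ : Field k) (_ : TopologicalSpace k) (_ : DiscreteTopology k)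
        (j : ZMod 3 →+* k) (ιf : coeffCharIntegers f →+* k),
        Mf ∣ D * M * ∏ p ∈ C.erase q, p ^ 2 ∧
          ∀ᶠ ℓ : Nat.Primes in Filter.cofinite,
            ∃ P : Polynomial (coeffCharIntegers f),
              P.map (algebraMap (coeffCharIntegers f) (coeffCharField f)) = heckePolynomial f ℓ ∧
                P.map ιf = Polynomial.X ^ 2 - Polynomial.C (j ((a ℓ : ℤ) : ZMod 3)) * Polynomial.X +
                  Polynomial.C (j ((ℓ : ℕ) : ZMod 3))

/-! ## §6 (EIG′) r2 — the certificate's output, typed with the parabolic clause -/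

/-- **(EIG) `PeriodCharacterCuspidalEigenPackageAtThree`** [CERTIFICATE CURRENCY — to be PROVED from the inert-Hecke certificate; nothing asserted, not a print
input]. Binders and hypotheses VERBATIM those of (CONG) `CongruentNewformOfLevelPrimeToCartanPlaceAtThree` (so of (MOD) ∕ (CAR)); conclusion: there are an abelian group
`A`, a cochain `χ̄ : ι(O₀'¹) → A` on `coverUnits X q` and a finite set `S` of primes with `χ̄` additive, `3`-torsion, non-zero, null on every element of finite order and on
every parabolic element, and `T_ℓ χ̄ = a_ℓ(W₁)·χ̄` (a datum representing `ι(O₀'¹)∖ι(O₀'(ℓ))`, eigenvalue `W₁.LFunction ℓ`) for every prime `ℓ ∉ S` — exactly the input of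
(LIFT). ITS PROOF IS THE CERTIFICATE (parts A–C `…CartanCoverHeckeDatum{,Cover,Certificate}` + (SIMREP) + (CHEB) + the `ℙ¹(𝔽_ℓ)`-cosets): `A := ℂ ∕ 3Λ`, `χ̄ := χ mod 3Λ`
(T14a `redThree_cochain`: additive, `3`-torsion); non-zero because `χ̄ = (c·per_F)‾` on `Γ̄(q)` (T14b) and the last hypothesis says `(c·per_F)‾ ≠ 0` there
(`redThree_eq_zero_iff`); eigen at every prime `ℓ ∤ q·D·M·∏C` with eigenvalue `a_ℓ(W₁)` by (T12′) `cover_op_eq_smul_of_agree_on` fed with (SIMREP)'s representatives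
(clauses (i), (ii), (iv); `CartanCover.le_coverOrder`), (T11c′) + (T14c) and `Q.hecke_eq`; null on `x` with `x³ = ±1` by (T13′) at ONE prime `ℓ ≡ 2 (3)`, `3 ∤ a_ℓ(W₁) =
a_ℓ(V)` ((CHEB) for `Surj V 3`, isogeny invariance) with `hfix` from (T6) and the `ℙ¹(𝔽_ℓ)`-identification of the `ℓ + 1` cosets; null on `±1` and on `x` with `x² = -1`
since `2χ̄(x) = χ̄(x²) ∈ {χ̄(1), χ̄(-1)} = 0` and `3χ̄(x) = 0`; these are all the finite orders in `ι(O₀'¹)` (`φ(n) ≤ 2`); null on a parabolic `x` (r2): `(x ∓ 1)² = 0`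
(Cayley–Hamilton, `det x = 1`, `tr x = ±2`), so `x^{2q} = 1 + q·(2(±x − 1))` lies in `CartanCover.principalLevel X q` and is parabolic
(`Matrix.GeneralLinearGroup.IsParabolic.pow`); the third hypothesis gives `χ̄(x^{2q}) = (c·per_F(x^{2q}))‾`, and (PAR) «`segmentIntegral Q.form z₀ (β • z₀) = 0` for a
parabolic `β ∈ X.Gamma`» (`CuspForm.zero_at_cusps'` at the cusp `IsCusp` fixed by `β`, periodicity of `Q.form ∣[2] g`, Cauchy on a rectangle; `principalLevel ≤ Gamma`)
makes it `0`; hence `2q·χ̄(x) = 0`, and with `3χ̄(x) = 0`, `q ≠ 3`: `χ̄(x) = 0`. Why it might fail: only through (SIMREP) ∕ (PAR) ∕ the coset identification, each a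
print theorem ((CHEB) is the tree's `…CartanCoverChebotarevSupply`, p741814). [folklore] -/
@[conjecture]
def PeriodCharacterCuspidalEigenPackageAtThree : Prop :=
  ∀ (V : WeierstrassCurve ℚ) [V.IsElliptic], Surj V 3 →
    ∀ (N D M : ℕ) (C : Finset ℕ) (q : ℕ) [Fact q.Prime]
      (X : CartanLevelCurveData D M C) (W₁ : WeierstrassCurve ℚ) [W₁.IsElliptic] (Q : CartanParametrizationData X W₁),
      q ∈ C → V.conductorNorm ℤ = N → D * M * ∏ p ∈ C, p ^ 2 = N → q ≠ 3 → Q.IsMinimalFor V →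
      ∀ (c : ℂ) (χ : GL (Fin 2) ℝ → ℂ),
        (∀ γ ∈ CartanCover.coverUnits X q, χ γ ∈ Q.L.lattice) →
        (∀ γ ∈ CartanCover.coverUnits X q, ∀ δ ∈ CartanCover.coverUnits X q,
          ∃ y ∈ Q.L.lattice, χ (γ * δ) - χ γ - χ δ = 3 * y) →
        (∀ β ∈ CartanCover.principalLevel X q,
          ∃ y ∈ Q.L.lattice, χ β - c * segmentIntegral (⇑Q.form) Q.basePoint (β • Q.basePoint) = 3 * y) →
        (¬ ∀ β ∈ CartanCover.principalLevel X q,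
          ∃ y ∈ Q.L.lattice, c * segmentIntegral (⇑Q.form) Q.basePoint (β • Q.basePoint) = 3 * y) →
        ∃ (A : Type) (_ : AddCommGroup A) (χbar : CartanCover.coverUnits X q → A) (S : Finset ℕ),
          (∀ x y, χbar (x * y) = χbar x + χbar y) ∧ (∀ x, 3 • χbar x = 0) ∧ (∃ x, χbar x ≠ 0) ∧
            (∀ x, IsOfFinOrder x → χbar x = 0) ∧
            (∀ x : CartanCover.coverUnits X q, Matrix.GeneralLinearGroup.IsParabolic (x : GL (Fin 2) ℝ) → χbar x = 0) ∧
            ∀ ℓ : ℕ, ℓ.Prime → ℓ ∉ S →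
              ∃ (ι : Type) (_ : Fintype ι) (H : HeckeDatum (CartanCover.coverUnits X q) ι),
                (∀ i, H.α i ∈ unitsHeckeSet X.ι (O := CartanCover.coverOrder X q) ℓ) ∧
                (∀ g ∈ unitsHeckeSet X.ι (O := CartanCover.coverOrder X q) ℓ, ∃ i, ∃ u ∈ CartanCover.coverUnits X q, u * g = H.α i) ∧
                ∀ x, H.op χbar x = (W₁.LFunction ℓ : ℤ) • χbar x

/-! ## §7 r2 — the composition (PROVED): LIFT′ ∧ EIG′ ⟹ CONG ⟹ (with thm61) OBS, (D4); deprecation of the r1 statements -/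

/-- **CONG from LIFT and the certificate's package.** Apply (EIG) to the hypotheses of (CONG), feed the package to (LIFT) with `a := (a_ℓ(W₁))_ℓ`, and
translate: `q ∤ M_f` (`not_dvd_of_dvd_coverLevel`); along `primesEquiv` the cofinite set of primes is a cofinite set of places, at the good ones
`a_{ℓ_v}(W₁) = a_v(V)` (`lFunction_primesEquiv_eq_frobeniusTraceAt_of_isIsogenous`, `Q.IsMinimalFor V` gives the isogeny) and `#k_v = ℓ_v`
(`natCard_residueField_adicCompletionIntegers`). [folklore] -/
theorem congruentNewform_of_cuspLift (hLIFT : CuspidalEigenCochainLiftPrimeToCartanPlaceAtThree) (hEIG : PeriodCharacterCuspidalEigenPackageAtThree) :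
    CongruentNewformOfLevelPrimeToCartanPlaceAtThree := by
  intro V _ hS N D M C q _ X W₁ _ Q hq hN hDMC hq3 hmin c χ hχΛ hχadd hχres hne
  obtain ⟨A, _, χb, S, hadd, h3, hne', htor, hpar, heig⟩ :=
    hEIG V hS N D M C q X W₁ Q hq hN hDMC hq3 hmin c χ hχΛ hχadd hχres hne
  obtain ⟨Mf, hMf, f, hf, k, _, _, _, j, ιf, hlev, hcong⟩ :=
    hLIFT D M C X q hq A χb (fun ℓ ↦ W₁.LFunction ℓ) S hadd h3 hne' htor hpar heig
  refine ⟨Mf, hMf, f, hf, k, inferInstance, inferInstance, inferInstance, j, ιf, not_dvd_of_dvd_coverLevel X hq hlev, ?_⟩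
  have hcong' : ∀ᶠ v : HeightOneSpectrum (𝓞 ℚ) in Filter.cofinite, ∃ P : Polynomial (coeffCharIntegers f),
      P.map (algebraMap (coeffCharIntegers f) (coeffCharField f)) = heckePolynomial f (primesEquiv v) ∧
        P.map ιf = Polynomial.X ^ 2 - Polynomial.C (j ((W₁.LFunction (primesEquiv v : ℕ) : ℤ) : ZMod 3)) * Polynomial.X +
          Polynomial.C (j (((primesEquiv v : Nat.Primes) : ℕ) : ZMod 3)) :=
    (primesEquiv.injective.tendsto_cofinite).eventually hcong
  filter_upwards [hcong', V.eventually_hasGoodReductionAt (K := ℚ)] with v hP hv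
  obtain ⟨P, hP1, hP2⟩ := hP
  refine ⟨P, hP1, ?_⟩
  rw [hP2, lFunction_primesEquiv_eq_frobeniusTraceAt_of_isIsogenous hmin.1 hv, natCard_residueField_adicCompletionIntegers v]

/-- OBS from LIFT and the package, granted Deligne's theorem (`noModThreePeriodCharacterExtension_of_congruentNewform`). -/
theorem noModThreePeriodCharacterExtension_of_cuspLift (h61 : DeligneSerre1974.thm61_exists_adicGaloisRep)
    (hLIFT : CuspidalEigenCochainLiftPrimeToCartanPlaceAtThree) (hEIG : PeriodCharacterCuspidalEigenPackageAtThree) :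
    CartanCover.Charext.NoModThreePeriodCharacterExtension :=
  noModThreePeriodCharacterExtension_of_congruentNewform h61 (congruentNewform_of_cuspLift hLIFT hEIG)

/-- `(M) → (M0) → LIFT → EIG → D4`, granted Deligne's theorem (`saturationAtThree_of_congruentNewform`). -/
theorem saturationAtThree_of_cuspLift (h61 : DeligneSerre1974.thm61_exists_adicGaloisRep)
    (hM : CartanCover.PeriodLatticeCharacter) (hM0 : CartanCover.Charext.StrongApproxAtCartanPlace)
    (hLIFT : CuspidalEigenCochainLiftPrimeToCartanPlaceAtThree) (hEIG : PeriodCharacterCuspidalEigenPackageAtThree) : CartanCover.SaturationAtThree :=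
  saturationAtThree_of_congruentNewform h61 hM hM0 (congruentNewform_of_cuspLift hLIFT hEIG)

-- r1's (LIFT) is false at `D = 1` (critic V214): use the cuspidal statement.
attribute [deprecated CuspidalEigenCochainLiftPrimeToCartanPlaceAtThree (since := "2026-08-29")] EigenCochainLiftPrimeToCartanPlaceAtThree

-- r1's (EIG) lacks the parabolic-null conjunct the cuspidal lift needs: use the cuspidal package.
attribute [deprecated PeriodCharacterCuspidalEigenPackageAtThree (since := "2026-08-29")] PeriodCharacterEigenPackageAtThree

end Summit.BirchSwinnertonDyer.BirchSwinnertonDyer.Theorems.CartanCarayol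

end
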